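import Literature.Computability.AlgebraicComplexity.QuantumFunctionalsUpperKroneckerRuleProofs
import Literature.Computability.AlgebraicComplexity.QuantumFunctionalsSemiInvariant
import Literature.RepresentationTheory.FiniteGroups.WordIsotypicProjectors
import HarnessLib

/-!
# Bridge: the isotypic character sums of `QuantumFunctionalsUpper.lean` are the projectors `P_λ`

Topic `Literature/Computability/AlgebraicComplexity`; infrastructure for the discharge of the named
fact `ChristandlVranaZuiddam2023_upper_eq_lower` (CVZ Thm. 3.30, `QuantumFunctionalsUpper.lean`),
the last open ingredient of `ChristandlVranaZuiddam2023_kronecker` (via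
`ChristandlVranaZuiddam2023_kronecker_of_upper` and the proved
`ChristandlVranaZuiddam2023_upper_submultiplicative_holds`). The upper functional of the tree is
defined through the unnormalised character sums `isotypicSumⱼ λ u = ∑_π χ_λ(π) (π ·ⱼ u)` on tensor
powers indexed by words over arbitrary finite index types; the representation theory proved in
`Literature/RepresentationTheory/FiniteGroups/` (`wordIsotypicMatrix`: the genuine isotypic
projectors `P_λ` as Hermitian idempotent matrices on words over `Fin N`, complete and orthogonal,
commuting with `A^{⊗n}`; the majorisation property, `WordIsotypicDominance.lean`) is stated for the
alphabet `Fin N`. This file PROVES the identification on alphabets `Fin N` (the general case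
reduces to it by reindexing letters):

* `actTensor_wordIsotypicMatrix_fst/snd/thd` — `(P_λ ⊗ 1 ⊗ 1)·u = (χ_λ(1)/n!) • isotypicSum₁ λ u`
  (and legs 2, 3), i.e. `isotypicSumⱼ λ = (n!/f^λ) P_λ^{V_j}`;
* `isotypicSum₁/₂/₃_ne_zero_iff` — hence `isotypicSumⱼ λ u ≠ 0 ↔ P_λ^{V_j} u ≠ 0`
  (`χ_λ(1) = f^λ ≠ 0`, `spechtCharacter_one_ne_zero`).

## References

* M. Christandl, P. Vrana, J. Zuiddam, J. Amer. Math. Soc. 36 (2023) = arXiv:1709.07851v3, §3.1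
  (the projectors `P_λ^V`; Def. 3.3). [ChristandlVranaZuiddam2023]
* J.-P. Serre, *Linear Representations of Finite Groups*, §2.6 Thm. 8 (the projector is
  `(χ(1)/|G|) ∑ χ(t) ρ(t⁻¹)`). [SerreLinearRepresentations1977]
-/

noncomputable section

open scoped BigOperators Matrix
open Literature.RepresentationTheory.FiniteGroups (wordIsotypicMatrix wordIsotypicMatrix_apply
  spechtCharacter_inv)
open Literature.NumberTheory.DiophantineGeometry (Word spechtCharacter)

namespace Literature.Computability.AlgebraicComplexity

variable {N n : ℕ} {κ' μ' : Type*} [Fintype κ'] [Fintype μ'] [DecidableEq κ'] [DecidableEq μ']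

/-- The sum `∑_t [a' = a ∘ t⁻¹] c(t) g(a')` over words `a'` collapses. [folklore] -/
theorem sum_wordIsotypicMatrix_mul (lam : Nat.Partition n) (a : Word N n) (g : Word N n → ℂ) :
    ∑ a' : Word N n, wordIsotypicMatrix N n lam a a' * g a' =
      spechtCharacter ℂ lam 1 / Fintype.card (Equiv.Perm (Fin n)) *
        ∑ π : Equiv.Perm (Fin n), spechtCharacter ℂ lam π * g (a ∘ ⇑π) := by
  simp only [wordIsotypicMatrix_apply, Finset.sum_mul, ite_mul, zero_mul]
  rw [Finset.sum_comm]
  simp only [Finset.sum_ite_eq', Finset.mem_univ, if_true]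
  rw [Finset.mul_sum]
  -- reindex `t ↦ t⁻¹` and use `χ(t⁻¹) = χ(t)`
  refine Fintype.sum_equiv (Equiv.inv (Equiv.Perm (Fin n))) _ _ fun t => ?_
  simp only [Equiv.inv_apply, spechtCharacter_inv]
  ring

/-- **`(P_λ ⊗ 1 ⊗ 1)·u = (χ_λ(1)/n!) • isotypicSum₁ λ u`** on the alphabet `Fin N`: the tree's
unnormalised isotypic character sum on the first factor is `n!/f^λ` times the action of the isotypic
projector matrix `P_λ` on the first leg. [cite: ChristandlVranaZuiddam2023, §3.1] -/
theorem actTensor_wordIsotypicMatrix_fst (lam : Nat.Partition n)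
    (u : Word N n → (Fin n → κ') → (Fin n → μ') → ℂ) :
    actTensor (wordIsotypicMatrix N n lam) (1 : Matrix (Fin n → κ') (Fin n → κ') ℂ)
        (1 : Matrix (Fin n → μ') (Fin n → μ') ℂ) u =
      (spechtCharacter ℂ lam 1 / Fintype.card (Equiv.Perm (Fin n))) • isotypicSum₁ lam u := by
  funext a b c
  rw [actTensor_fst_apply, Pi.smul_apply, Pi.smul_apply, Pi.smul_apply, smul_eq_mul,
    isotypicSum₁_apply, sum_wordIsotypicMatrix_mul lam a (fun a' => u a' b c)]

/-- The same on the second factor: `(1 ⊗ P_λ ⊗ 1)·u = (χ_λ(1)/n!) • isotypicSum₂ λ u`.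
[cite: ChristandlVranaZuiddam2023, §3.1] -/
theorem actTensor_wordIsotypicMatrix_snd (lam : Nat.Partition n)
    (u : (Fin n → κ') → Word N n → (Fin n → μ') → ℂ) :
    actTensor (1 : Matrix (Fin n → κ') (Fin n → κ') ℂ) (wordIsotypicMatrix N n lam)
        (1 : Matrix (Fin n → μ') (Fin n → μ') ℂ) u =
      (spechtCharacter ℂ lam 1 / Fintype.card (Equiv.Perm (Fin n))) • isotypicSum₂ lam u := by
  funext a b c
  rw [actTensor_snd_apply, Pi.smul_apply, Pi.smul_apply, Pi.smul_apply, smul_eq_mul,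
    isotypicSum₂_apply, sum_wordIsotypicMatrix_mul lam b (fun b' => u a b' c)]

/-- The same on the third factor: `(1 ⊗ 1 ⊗ P_λ)·u = (χ_λ(1)/n!) • isotypicSum₃ λ u`.
[cite: ChristandlVranaZuiddam2023, §3.1] -/
theorem actTensor_wordIsotypicMatrix_thd (lam : Nat.Partition n)
    (u : (Fin n → κ') → (Fin n → μ') → Word N n → ℂ) :
    actTensor (1 : Matrix (Fin n → κ') (Fin n → κ') ℂ) (1 : Matrix (Fin n → μ') (Fin n → μ') ℂ)
        (wordIsotypicMatrix N n lam) u =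
      (spechtCharacter ℂ lam 1 / Fintype.card (Equiv.Perm (Fin n))) • isotypicSum₃ lam u := by
  funext a b c
  rw [actTensor_thd_apply, Pi.smul_apply, Pi.smul_apply, Pi.smul_apply, smul_eq_mul,
    isotypicSum₃_apply, sum_wordIsotypicMatrix_mul lam c (fun c' => u a b c')]

/-- The normalising scalar `χ_λ(1)/n! = f^λ/n!` is nonzero. [folklore] -/
theorem spechtCharacter_one_div_card_ne_zero (lam : Nat.Partition n) :
    spechtCharacter ℂ lam 1 / Fintype.card (Equiv.Perm (Fin n)) ≠ 0 :=
  div_ne_zero (spechtCharacter_one_ne_zero lam) (Nat.cast_ne_zero.2 Fintype.card_ne_zero)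

/-- **`isotypicSum₁ λ u ≠ 0 ↔ (P_λ ⊗ 1 ⊗ 1)·u ≠ 0`** (alphabet `Fin N`).
[cite: ChristandlVranaZuiddam2023, §3.1] -/
theorem isotypicSum₁_ne_zero_iff (lam : Nat.Partition n)
    (u : Word N n → (Fin n → κ') → (Fin n → μ') → ℂ) :
    isotypicSum₁ lam u ≠ 0 ↔ actTensor (wordIsotypicMatrix N n lam)
      (1 : Matrix (Fin n → κ') (Fin n → κ') ℂ) (1 : Matrix (Fin n → μ') (Fin n → μ') ℂ) u ≠ 0 := by
  rw [actTensor_wordIsotypicMatrix_fst, Ne, Ne, smul_eq_zero, not_or]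
  exact ⟨fun h => ⟨spechtCharacter_one_div_card_ne_zero lam, h⟩, fun h => h.2⟩

/-- `isotypicSum₂ λ u ≠ 0 ↔ (1 ⊗ P_λ ⊗ 1)·u ≠ 0` (alphabet `Fin N`).
[cite: ChristandlVranaZuiddam2023, §3.1] -/
theorem isotypicSum₂_ne_zero_iff (lam : Nat.Partition n)
    (u : (Fin n → κ') → Word N n → (Fin n → μ') → ℂ) :
    isotypicSum₂ lam u ≠ 0 ↔ actTensor (1 : Matrix (Fin n → κ') (Fin n → κ') ℂ)
      (wordIsotypicMatrix N n lam) (1 : Matrix (Fin n → μ') (Fin n → μ') ℂ) u ≠ 0 := by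
  rw [actTensor_wordIsotypicMatrix_snd, Ne, Ne, smul_eq_zero, not_or]
  exact ⟨fun h => ⟨spechtCharacter_one_div_card_ne_zero lam, h⟩, fun h => h.2⟩

/-- `isotypicSum₃ λ u ≠ 0 ↔ (1 ⊗ 1 ⊗ P_λ)·u ≠ 0` (alphabet `Fin N`).
[cite: ChristandlVranaZuiddam2023, §3.1] -/
theorem isotypicSum₃_ne_zero_iff (lam : Nat.Partition n)
    (u : (Fin n → κ') → (Fin n → μ') → Word N n → ℂ) :
    isotypicSum₃ lam u ≠ 0 ↔ actTensor (1 : Matrix (Fin n → κ') (Fin n → κ') ℂ)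
      (1 : Matrix (Fin n → μ') (Fin n → μ') ℂ) (wordIsotypicMatrix N n lam) u ≠ 0 := by
  rw [actTensor_wordIsotypicMatrix_thd, Ne, Ne, smul_eq_zero, not_or]
  exact ⟨fun h => ⟨spechtCharacter_one_div_card_ne_zero lam, h⟩, fun h => h.2⟩

end Literature.Computability.AlgebraicComplexity

end
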